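/-
Copyright (c) 2026 the pub-hodgecm-mathlib formalisation cell (harness21).  Prover seat hodgecm-mathlib-K2Liu-p01 (g12), Track B «K2-LIT» ∕ hLiu418 =
`stmt-HodgeConjecture-24832`; LEAD F0P6-plan (g16) BATCH #309 (a) «F2ζ ARCH PRODUCT ON THE LINE» (blueprint dd6a402ca97d3cd0 item (5), LH4-p14 (g9));
K1b desk K2Liu-p14 (g6).  THEOREMS ONLY (no `def`, no instance, no notation, no named-fact hypothesis, no `sorry`, default heartbeats); lane
`--supports stmt-HodgeConjecture-24832 --as helper`.
-/
import Summits.HodgeConjecture.HodgeConjecture.Theorems.K2LiuArchUnipotentFrameCoordinates   -- ★ FILE 12 `exists_frameCoordinates` (brings ★ FILE 11, ★ `frame_mul`, ★ `frame_archPart_weylDelta`, `hermOfReal`)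
import HarnessLib

/-!
# Crux `HLiu418`, socket #41, KIND 1 (K1-b♮), (dec-2-pay) F2ζ — `K2LiuKindOneLineArchWhittakerProduct`: THE ARCH PRODUCT ON THE LINE
# `∫_{N_Δ(L⁺⊗ℝ)} (∏_w e_w) · ∏_w F_w(Fr(x₀·u·h)_w) dν(u) = cν(ν) · ∏_w ∫_{ℝ^{n×n}} e_w(hermOfReal r)·F_w(Fr x₀ w · n(hermOfReal r) · Fr h w) dr`, ANY rank `n`, ANY integrands

Cell `hodgecm-mathlib`, hLiu418 = `stmt-HodgeConjecture-24832` (helper lane, count-neutral); squad K2 ∕ K2Liu, socket #41, KIND 1.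

THE POINT.  The K1-b♮ chain (blueprint (0)–(8)) reads the pulled-back LINE family over the doubled line `H_B = U(1,1)`; its archimedean Whittaker factor is an
integral over the line's Siegel unipotent `N_Δ^{(B)}(L⁺ ⊗ ℝ) ≅ ∏_σ ℝ` of a σ-PURE product (blueprint (5)).  Everything needed is ★ and GENERIC IN THE RANK `n`:
★ FILE 12 `exists_frameCoordinates` (`Φ : N_Δ(L⁺⊗ℝ) ≃ₜ ({σ} → ℝ^{n×n})`, `Φ(uv) = Φu + Φv`, `Fr u σ = n(hermOfReal (Φ u σ))`), ★ FILE 11 `exists_integral_comp_eq_smul`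
(Haar = `c` · Lebesgue through `Φ`), Mathlib `integral_fintype_prod_volume_eq_prod`, ★ `frame_mul`, ★ `frame_archPart_weylDelta`.  ★ p864162
`K2LiuKindWArchContinuationExplicit` §1–§3 did this at `n = 2` (hard-coded `Fin 2`) for FLAT families with per-place letters `Ew`; THIS FILE is the `n`-generic re-run
with ARBITRARY per-place integrands `F_w : M_{2n}(ℂ) → ℂ` (no flatness, no `Ew` letters — the per-place integrals stay EXPLICIT), an arbitrary left point `x₀`, and the
coordinates `Φ` EXPORTED next to the ratio `cν` (F2γ §5 `integrable_comp_of_addHaar_coordinates` consumes THIS `Φ`).  The LINE is the instance `n := 1`, `e := eB`,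
`dV := dB`; §4 reads the `Fin 1 → Fin 1 → ℝ` integrals as real-line integrals.
* §1 `integral_prod_eq_of_coordinates` — generic coordinates `Φ`, transport `(c, hc)` BY VALUE: the Haar integral of `(∏_w e_w(hermOfReal(Φ u w)))·∏_w F_w(x_w·n(hermOfReal(Φ u w))·g_w)`
  is `c · ∏_w ∫ e_w(hermOfReal r)·F_w(x_w·n(hermOfReal r)·g_w) dr`.
* §2 `integral_prod_eq_of_frame` — through a multiplicative frame on a group `A ≥ N`, left point `x₀`, right point `h`, weight read off the `(1,2)`-blocks.
* §3 **`exists_frameCoordinates_haarRatio_prod`** — THE RECORD CURRENCY (rank `n`, frames `T Tinv Fr hFr hT1 hT2 hTiv hTN` BY VALUE): `∃ Φ cν` (quantified FIRST, so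
  equal carriers give equal constants by `congrArg`) with (1) `Φ(uv) = Φu + Φv`, (2) `Fr u w = n(hermOfReal(Φ u w))`, (3) `∫ G(Φ u) dν = cν ν • ∫ G` for every Haar `ν`
  and every `G`, (4) the ARCH PRODUCT at any `x₀ h`, (5) the same at `x₀ := (w_Δ)_∞` with `Fr (w_Δ)_∞ w = T w·diag(1,−1)·Tinv w` read in.
* §4 `integral_fin_one_eq_integral_real` (`∫ over Fin 1 → Fin 1 → ℝ` = `∫ over ℝ`) and **`exists_frameCoordinates_haarRatio_lineProd`** — §3 (4)(5) at `n = 1` with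
  real-line factors `∫ t : ℝ, e_w(hermOfReal (fun _ _ => t)) · F_w(…·n(hermOfReal (fun _ _ => t))·…) dt` (`hermOfReal (fun _ _ => t) = (2t)`, real).
[Shimura1997, §16.4, §18.1 (18.4)]; [KudlaRallis1994, §1–§2]; [Folland1995, §2.2]; [BorelJacquet1979, §4.1]; [Kudla1994, §2].
HONEST LABEL.  Count-neutral helper; explicit `n`-generic twins of ★ results, no new analytic content: `HC_CM` is proved only modulo the 7 printed citations
(2 remaining named inputs: hLiu418 = `stmt-HodgeConjecture-24832`, h413 = `stmt-HodgeConjecture-24833`) until rung 0 closes.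

## References
* [Shimura1997] G. Shimura, *Euler Products and Eisenstein Series*, CBMS 93 (1997): §16.4, §18.1 (18.4).
* [KudlaRallis1994] S. Kudla, S. Rallis, *A regularized Siegel–Weil formula: the first term identity*, Ann. of Math. 140 (1994): §1–§2.
* [Folland1995] G. B. Folland, *A Course in Abstract Harmonic Analysis* (1995): §2.2 (uniqueness of Haar measure).
* [BorelJacquet1979] A. Borel, H. Jacquet, *Automorphic forms and automorphic representations*, PSPM 33.1 (1979): §4.1.
* [Kudla1994] S. Kudla, *Splitting metaplectic covers of dual reductive pairs*, Israel J. Math. 87 (1994): §2 (the see-saw line).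
-/

set_option autoImplicit false
set_option linter.dupNamespace false -- the mandated namespace repeats `HodgeConjecture.HodgeConjecture`

noncomputable section

open Complex Matrix MeasureTheory MeasureTheory.Measure NumberField
open scoped NNReal
open Literature.NumberTheory.Automorphic Literature.NumberTheory.GelbartRogawski1991 Literature.NumberTheory.GelbartRogawski1991.GRConstruction
open Literature.NumberTheory.K2Lit.SiegelDoubled
open Summit.HodgeConjecture.HodgeConjecture.Cruxes.HLiu418.K2LiuArchInducedTubeDefs
open Summit.HodgeConjecture.HodgeConjecture.Cruxes.HLiu418.K2LiuArchUnipotentHaarTransport (exists_integral_comp_eq_smul)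
open Summit.HodgeConjecture.HodgeConjecture.Cruxes.HLiu418.K2LiuArchUnipotentFrameCoordinates (exists_frameCoordinates)
open Summit.HodgeConjecture.HodgeConjecture.Cruxes.HLiu418.K2LiuSiegelUnipotentLocalDefs (unipDeltaArch IsUnipM)
open Summit.HodgeConjecture.HodgeConjecture.Cruxes.HLiu418.K2LiuHolTubeRigidityOfFrame (frame_mul frame_archPart_weylDelta)

namespace Summit.HodgeConjecture.HodgeConjecture.Cruxes.HLiu418.K2LiuKindOneLineArchWhittakerProduct

/-! ## §1 Generic coordinates and the Haar∕Lebesgue ratio by value -/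

/-- **THE PRODUCT IN COORDINATES.**  `σ` finite (places), `l` finite (rank); `x_w, g_w ∈ M_{2l}(ℂ)`; a measurable space `N` with coordinates `Φ : N → ∏_w ℝ^{l×l}`
read by a frame `Fr u w = n(hermOfReal (Φ u w))`; a measure `ν` on `N` with the transport identity `∫ G(Φ u) dν = c·∫ G d(Lebesgue)` BY VALUE (★ FILE 11's output);
a weight `∏_w e_w(hermOfReal(Φ u w))` and ARBITRARY per-place integrands `F_w`.  Then
`∫_N (∏_w e_w(hermOfReal(Φ u w)))·∏_w F_w(x_w·Fr u w·g_w) dν(u) = c·∏_w ∫ e_w(hermOfReal r)·F_w(x_w·n(hermOfReal r)·g_w) dr` (Mathlib `integral_fintype_prod_volume_eq_prod`,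
unconditional). [cite: Shimura1997, §16.4] [cite: KudlaRallis1994, §1–§2] [cite: Folland1995, §2.2] -/
theorem integral_prod_eq_of_coordinates {σ : Type*} [Fintype σ] {l : Type*} [Fintype l] [DecidableEq l]
    (x g : σ → Matrix (l ⊕ l) (l ⊕ l) ℂ)
    {N : Type*} [MeasurableSpace N] (Φ : N → (σ → (l → l → ℝ)))
    (Fr : N → σ → Matrix (l ⊕ l) (l ⊕ l) ℂ) (hFr : ∀ u w, Fr u w = fromBlocks 1 (hermOfReal (Φ u w)) 0 1)
    (ν : Measure N) (c : ℝ≥0) (hc : ∀ G : (σ → (l → l → ℝ)) → ℂ, ∫ u, G (Φ u) ∂ν = c • ∫ r, G r)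
    (eb : σ → Matrix l l ℂ → ℂ) (F : σ → Matrix (l ⊕ l) (l ⊕ l) ℂ → ℂ) :
    ∫ u, (∏ w, eb w (hermOfReal (Φ u w))) * ∏ w, F w (x w * Fr u w * g w) ∂ν =
      ((c : ℝ) : ℂ) * ∏ w, ∫ r : l → l → ℝ, eb w (hermOfReal r) * F w (x w * fromBlocks 1 (hermOfReal r) 0 1 * g w) := by
  have hG := hc (fun r : σ → (l → l → ℝ) =>
    (∏ w, eb w (hermOfReal (r w))) * ∏ w, F w (x w * fromBlocks 1 (hermOfReal (r w)) 0 1 * g w))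
  have hint : ∫ u, (∏ w, eb w (hermOfReal (Φ u w))) * ∏ w, F w (x w * Fr u w * g w) ∂ν =
      ∫ u, (fun r : σ → (l → l → ℝ) => (∏ w, eb w (hermOfReal (r w))) * ∏ w, F w (x w * fromBlocks 1 (hermOfReal (r w)) 0 1 * g w)) (Φ u) ∂ν :=
    integral_congr_ae (Filter.Eventually.of_forall fun u => by simp only [hFr])
  have hprod : (fun r : σ → (l → l → ℝ) => (∏ w, eb w (hermOfReal (r w))) * ∏ w, F w (x w * fromBlocks 1 (hermOfReal (r w)) 0 1 * g w)) =
      fun r => ∏ w, (eb w (hermOfReal (r w)) * F w (x w * fromBlocks 1 (hermOfReal (r w)) 0 1 * g w)) := by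
    funext r
    rw [← Finset.prod_mul_distrib]
  rw [hint, hG, hprod, integral_fintype_prod_volume_eq_prod
    (fun w (r : l → l → ℝ) => eb w (hermOfReal r) * F w (x w * fromBlocks 1 (hermOfReal r) 0 1 * g w)),
    NNReal.smul_def, Complex.real_smul]

/-! ## §2 Through a multiplicative frame on a bigger group -/

/-- **THE PRODUCT THROUGH A MULTIPLICATIVE FRAME** (any rank, any integrands): `A` a group with a multiplicative frame `Fr`, `N ≤ A` with coordinates `Φ` read by the
frame, the transport identity `(c, hc)` for `ν` on `N` BY VALUE, a left point `x₀` and a right point `h` in `A`, the weight read off the `(1,2)`-blocks (`hWt`).  Then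
`∫_N Wt u · ∏_w F_w(Fr(x₀·u·h)_w) dν = c · ∏_w ∫ e_w(hermOfReal r)·F_w(Fr x₀ w · n(hermOfReal r) · Fr h w) dr`. [cite: Shimura1997, §16.4] [cite: BorelJacquet1979, §4.1] -/
theorem integral_prod_eq_of_frame {σ : Type*} [Fintype σ] {l : Type*} [Fintype l] [DecidableEq l]
    {A : Type*} [Group A]
    (Fr : A → σ → Matrix (l ⊕ l) (l ⊕ l) ℂ) (hmul : ∀ a b w, Fr (a * b) w = Fr a w * Fr b w)
    (N : Subgroup A) [MeasurableSpace N]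
    (Φ : N → (σ → (l → l → ℝ))) (hFr : ∀ (u : N) w, Fr (u : A) w = fromBlocks 1 (hermOfReal (Φ u w)) 0 1)
    (ν : Measure N) (c : ℝ≥0) (hc : ∀ G : (σ → (l → l → ℝ)) → ℂ, ∫ u, G (Φ u) ∂ν = c • ∫ r, G r)
    (x₀ h : A) (eb : σ → Matrix l l ℂ → ℂ) (Wt : N → ℂ) (hWt : ∀ u : N, Wt u = ∏ w, eb w (Matrix.toBlocks₁₂ (Fr (u : A) w)))
    (F : σ → Matrix (l ⊕ l) (l ⊕ l) ℂ → ℂ) :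
    ∫ u : N, Wt u * ∏ w, F w (Fr (x₀ * (u : A) * h) w) ∂ν =
      ((c : ℝ) : ℂ) * ∏ w, ∫ r : l → l → ℝ, eb w (hermOfReal r) * F w (Fr x₀ w * fromBlocks 1 (hermOfReal r) 0 1 * Fr h w) := by
  have hint : ∫ u : N, Wt u * ∏ w, F w (Fr (x₀ * (u : A) * h) w) ∂ν =
      ∫ u : N, (∏ w, eb w (hermOfReal (Φ u w))) * ∏ w, F w (Fr x₀ w * Fr (u : A) w * Fr h w) ∂ν :=
    integral_congr_ae (Filter.Eventually.of_forall fun u => by simp only [hWt, hmul, hFr, Matrix.toBlocks_fromBlocks₁₂])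
  rw [hint]
  exact integral_prod_eq_of_coordinates (fun w => Fr x₀ w) (fun w => Fr h w) Φ (fun (u : N) w => Fr (u : A) w) hFr ν c hc eb F

/-! ## §3 The record currency: the coordinates and ONE ratio function of the carrier, any rank `n` -/

variable (L : Type) [Field L] [NumberField L] [IsCMField L]
variable {N₀ M₀ n : ℕ} (e : Fin N₀ × Fin M₀ ≃ Fin n)
  (dV : Fin N₀ → L) (hdV : ∀ i, IsCMField.complexConj L (dV i) = dV i)
  (dW : Fin M₀ → L) (hdW : ∀ i, IsCMField.complexConj L (dW i) = dW i)
  (T Tinv : {w : InfinitePlace L // w.IsComplex} → Matrix (Fin n ⊕ Fin n) (Fin n ⊕ Fin n) ℂ)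
  (Fr : UnitaryGroup.arch (Fp L) L (IsCMField.complexConj L) (n + n) (hermD L e dV hdV dW hdW) →
    {w : InfinitePlace L // w.IsComplex} → Matrix (Fin n ⊕ Fin n) (Fin n ⊕ Fin n) ℂ)
  (hFr : ∀ a w, Fr a w = T w * Matrix.reindex (e₂ (n := n)).symm (e₂ (n := n)).symm
    (((UnitaryGroup.archAt (Fp L) L (IsCMField.complexConj L) (n + n) (hermD L e dV hdV dW hdW) w
      (UnitaryGroup.complexConj_smul_infinitePlace L w.1) (IsCMField.complexConj_ne_one L) a :
        UnitaryGroup.archLocal L (n + n) (hermD L e dV hdV dW hdW) w) : GL (Fin (n + n)) ℂ) : Matrix (Fin (n + n)) (Fin (n + n)) ℂ) * Tinv w)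
  (hT1 : ∀ w, T w * Tinv w = 1) (hT2 : ∀ w, Tinv w * T w = 1)
  (hTiv : ∀ w (u : GL (Fin (n + n)) ℂ), u ∈ UnitaryGroup.archLocal L (n + n) (hermD L e dV hdV dW hdW) w →
    IsUnipM (n := n) (u : Matrix (Fin (n + n)) (Fin (n + n)) ℂ) →
      ∃ b : Matrix (Fin n) (Fin n) ℂ, bᴴ = b ∧ T w * Matrix.reindex (e₂ (n := n)).symm (e₂ (n := n)).symm (u : Matrix _ _ ℂ) * Tinv w = fromBlocks 1 b 0 1)
  (hTN : ∀ w (b : Matrix (Fin n) (Fin n) ℂ), bᴴ = b → ∃ u : GL (Fin (n + n)) ℂ,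
    u ∈ UnitaryGroup.archLocal L (n + n) (hermD L e dV hdV dW hdW) w ∧ IsUnipM (n := n) (u : Matrix (Fin (n + n)) (Fin (n + n)) ℂ) ∧
      T w * Matrix.reindex (e₂ (n := n)).symm (e₂ (n := n)).symm (u : Matrix _ _ ℂ) * Tinv w = fromBlocks 1 b 0 1)
  [MeasurableSpace ↥(unipDeltaArch L e dV hdV dW hdW)] [BorelSpace ↥(unipDeltaArch L e dV hdV dW hdW)]
  [Fintype {w : InfinitePlace L // w.IsComplex}]

include hFr hT1 hT2 hTiv hTN in
/-- **THE ARCH PRODUCT OF RECORD, ANY RANK `n`** — the frame coordinates AND one ratio function of the carrier, quantified FIRST.  Under the by-value tube frames of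
record `(T, Tinv, Fr, hFr, hT1, hT2, hTiv, hTN)`: `∃ Φ cν` with (1) `Φ(uv) = Φ u + Φ v`; (2) `Fr u w = n(hermOfReal (Φ u w))` for `u ∈ N_Δ(L⁺ ⊗ ℝ)`; (3) for EVERY Haar
`ν` and EVERY `G`, `∫ G(Φ u) dν(u) = cν ν • ∫ G`; (4) for every Haar `ν`, points `x₀ h ∈ H_∞`, weight `Wt u = ∏_w e_w(toBlocks₁₂ (Fr u w))` and ARBITRARY integrands
`F_w`, `∫ Wt u·∏_w F_w(Fr(x₀·u·h) w) dν(u) = cν ν·∏_w ∫ e_w(hermOfReal r)·F_w(Fr x₀ w·n(hermOfReal r)·Fr h w) dr`; (5) the same at `x₀ := (w_Δ)_∞` with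
`Fr (w_Δ)_∞ w = T w·diag(1,−1)·Tinv w` (★ `frame_archPart_weylDelta`) read in.  (★ FILE 12 coordinates once, ★ FILE 11 per Haar `ν`, §2 with ★ `frame_mul`.)
[cite: Shimura1997, §16.4, §18.1 (18.4)] [cite: KudlaRallis1994, §1–§2] [cite: BorelJacquet1979, §4.1] [cite: Folland1995, §2.2] -/
theorem exists_frameCoordinates_haarRatio_prod :
    ∃ (Φ : ↥(unipDeltaArch L e dV hdV dW hdW) ≃ₜ ({w : InfinitePlace L // w.IsComplex} → (Fin n → Fin n → ℝ)))
      (cν : Measure ↥(unipDeltaArch L e dV hdV dW hdW) → ℝ≥0),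
      (∀ u v, Φ (u * v) = Φ u + Φ v) ∧
      (∀ (u : ↥(unipDeltaArch L e dV hdV dW hdW)) (w : {w : InfinitePlace L // w.IsComplex}),
        Fr (u : UnitaryGroup.arch (Fp L) L (IsCMField.complexConj L) (n + n) (hermD L e dV hdV dW hdW)) w = fromBlocks 1 (hermOfReal (Φ u w)) 0 1) ∧
      (∀ (ν : Measure ↥(unipDeltaArch L e dV hdV dW hdW)) [ν.IsHaarMeasure]
        (G : ({w : InfinitePlace L // w.IsComplex} → (Fin n → Fin n → ℝ)) → ℂ), ∫ u, G (Φ u) ∂ν = cν ν • ∫ r, G r) ∧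
      (∀ (ν : Measure ↥(unipDeltaArch L e dV hdV dW hdW)) [ν.IsHaarMeasure]
        (x₀ h : UnitaryGroup.arch (Fp L) L (IsCMField.complexConj L) (n + n) (hermD L e dV hdV dW hdW))
        (eb : {w : InfinitePlace L // w.IsComplex} → Matrix (Fin n) (Fin n) ℂ → ℂ) (Wt : ↥(unipDeltaArch L e dV hdV dW hdW) → ℂ),
        (∀ u : ↥(unipDeltaArch L e dV hdV dW hdW),
          Wt u = ∏ w, eb w (Matrix.toBlocks₁₂ (Fr (u : UnitaryGroup.arch (Fp L) L (IsCMField.complexConj L) (n + n) (hermD L e dV hdV dW hdW)) w))) →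
        ∀ F : {w : InfinitePlace L // w.IsComplex} → Matrix (Fin n ⊕ Fin n) (Fin n ⊕ Fin n) ℂ → ℂ,
          ∫ u : ↥(unipDeltaArch L e dV hdV dW hdW), Wt u * ∏ w, F w (Fr
              (x₀ * (u : UnitaryGroup.arch (Fp L) L (IsCMField.complexConj L) (n + n) (hermD L e dV hdV dW hdW)) * h) w) ∂ν =
            ((cν ν : ℝ) : ℂ) * ∏ w, ∫ r : Fin n → Fin n → ℝ, eb w (hermOfReal r) * F w (Fr x₀ w * fromBlocks 1 (hermOfReal r) 0 1 * Fr h w)) ∧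
      (∀ (ν : Measure ↥(unipDeltaArch L e dV hdV dW hdW)) [ν.IsHaarMeasure]
        (h : UnitaryGroup.arch (Fp L) L (IsCMField.complexConj L) (n + n) (hermD L e dV hdV dW hdW))
        (eb : {w : InfinitePlace L // w.IsComplex} → Matrix (Fin n) (Fin n) ℂ → ℂ) (Wt : ↥(unipDeltaArch L e dV hdV dW hdW) → ℂ),
        (∀ u : ↥(unipDeltaArch L e dV hdV dW hdW),
          Wt u = ∏ w, eb w (Matrix.toBlocks₁₂ (Fr (u : UnitaryGroup.arch (Fp L) L (IsCMField.complexConj L) (n + n) (hermD L e dV hdV dW hdW)) w))) →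
        ∀ F : {w : InfinitePlace L // w.IsComplex} → Matrix (Fin n ⊕ Fin n) (Fin n ⊕ Fin n) ℂ → ℂ,
          ∫ u : ↥(unipDeltaArch L e dV hdV dW hdW), Wt u * ∏ w, F w (Fr
              (UnitaryGroup.archPart (Fp L) L (IsCMField.complexConj L) (n + n) (hermD L e dV hdV dW hdW) (weylDelta L e dV hdV dW hdW) *
                (u : UnitaryGroup.arch (Fp L) L (IsCMField.complexConj L) (n + n) (hermD L e dV hdV dW hdW)) * h) w) ∂ν =
            ((cν ν : ℝ) : ℂ) * ∏ w, ∫ r : Fin n → Fin n → ℝ, eb w (hermOfReal r) *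
              F w (T w * fromBlocks 1 0 0 (-1) * Tinv w * fromBlocks 1 (hermOfReal r) 0 1 * Fr h w)) := by
  classical
  -- the frame coordinates of record (★ FILE 12), chosen ONCE
  obtain ⟨Φ, hΦ, hΦFr⟩ := exists_frameCoordinates L e dV hdV dW hdW T Tinv Fr hFr hT1 hT2 hTiv hTN
  -- Lebesgue on `∏_w ℝ^{n×n}` is an additive Haar measure
  haveI hnn : (volume : Measure (Fin n → Fin n → ℝ)).IsAddHaarMeasure := Measure.pi.isAddHaarMeasure _
  haveI : (volume : Measure ({w : InfinitePlace L // w.IsComplex} → (Fin n → Fin n → ℝ))).IsAddHaarMeasure := Measure.pi.isAddHaarMeasure _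
  -- ★ FILE 11 per Haar carrier: the ratio as a function of the carrier
  have key : ∀ ν : Measure ↥(unipDeltaArch L e dV hdV dW hdW), ν.IsHaarMeasure →
      ∃ c : ℝ≥0, ∀ G : ({w : InfinitePlace L // w.IsComplex} → (Fin n → Fin n → ℝ)) → ℂ, ∫ u, G (Φ u) ∂ν = c • ∫ r, G r := fun ν hν =>
    exists_integral_comp_eq_smul volume Φ hΦ ν (F := ℂ)
  choose cfun hcfun using key
  refine ⟨Φ, fun ν => if hν : ν.IsHaarMeasure then cfun ν hν else 0, hΦ, hΦFr, ?_, ?_, ?_⟩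
  · intro ν hν G
    beta_reduce
    rw [dif_pos hν]
    exact hcfun ν hν G
  · intro ν hν x₀ h eb Wt hWt F
    beta_reduce
    rw [dif_pos hν]
    exact integral_prod_eq_of_frame Fr (fun a b w => frame_mul L e dV hdV dW hdW T Tinv Fr hFr hT2 a b w)
      (unipDeltaArch L e dV hdV dW hdW) Φ hΦFr ν (cfun ν hν) (hcfun ν hν) x₀ h eb Wt hWt F
  · intro ν hν h eb Wt hWt F
    have h4 := integral_prod_eq_of_frame Fr (fun a b w => frame_mul L e dV hdV dW hdW T Tinv Fr hFr hT2 a b w)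
      (unipDeltaArch L e dV hdV dW hdW) Φ hΦFr ν (cfun ν hν) (hcfun ν hν)
      (UnitaryGroup.archPart (Fp L) L (IsCMField.complexConj L) (n + n) (hermD L e dV hdV dW hdW) (weylDelta L e dV hdV dW hdW)) h eb Wt hWt F
    beta_reduce
    rw [dif_pos hν, h4]
    exact congrArg _ (Finset.prod_congr rfl fun w _ => by rw [frame_archPart_weylDelta L e dV hdV dW hdW T Tinv Fr hFr w])

/-! ## §4 The LINE (`n = 1`): real-line factors -/

/-- `∫ over Fin 1 → Fin 1 → ℝ` IS `∫ over ℝ`: `∫ r, G r = ∫ t : ℝ, G (fun _ _ => t)` (Mathlib `volume_preserving_funUnique`, twice). [folklore] -/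
theorem integral_fin_one_eq_integral_real {E : Type*} [NormedAddCommGroup E] [NormedSpace ℝ E] (G : (Fin 1 → Fin 1 → ℝ) → E) :
    ∫ r : Fin 1 → Fin 1 → ℝ, G r = ∫ t : ℝ, G (fun _ _ => t) := by
  have hmp : MeasurePreserving (⇑((MeasurableEquiv.funUnique (Fin 1) (Fin 1 → ℝ)).trans (MeasurableEquiv.funUnique (Fin 1) ℝ))) volume volume :=
    (volume_preserving_funUnique (Fin 1) ℝ).comp (volume_preserving_funUnique (Fin 1) (Fin 1 → ℝ))
  rw [← (hmp.symm _).integral_comp' G]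
  rfl

/-- **THE ARCH PRODUCT ON THE LINE (`n = 1`).**  §3 at rank one (`e : Fin N₀ × Fin M₀ ≃ Fin 1`, the doubled line `H_B = U(1,1)`, its Siegel unipotent
`N_Δ^{(B)}(L⁺ ⊗ ℝ) ≅ ∏_σ ℝ`), with the per-place factors read as REAL-LINE integrals: `∃ Φ cν` with (1)(2)(3) as in §3 and (4′)(5′) = (4)(5) with
`∫ t : ℝ, e_w(hermOfReal (fun _ _ => t))·F_w(…·n(hermOfReal (fun _ _ => t))·…) dt` (`hermOfReal (fun _ _ => t) = (2t)`).  Blueprint dd6a402ca97d3cd0 item (5).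
[cite: Kudla1994, §2] [cite: Shimura1997, §16.4, §18.1 (18.4)] [cite: BorelJacquet1979, §4.1] [cite: Folland1995, §2.2] -/
theorem exists_frameCoordinates_haarRatio_lineProd {N₁ M₁ : ℕ} (e₁ : Fin N₁ × Fin M₁ ≃ Fin 1)
    (dV₁ : Fin N₁ → L) (hdV₁ : ∀ i, IsCMField.complexConj L (dV₁ i) = dV₁ i)
    (dW₁ : Fin M₁ → L) (hdW₁ : ∀ i, IsCMField.complexConj L (dW₁ i) = dW₁ i)
    (T₁ T₁inv : {w : InfinitePlace L // w.IsComplex} → Matrix (Fin 1 ⊕ Fin 1) (Fin 1 ⊕ Fin 1) ℂ)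
    (Fr₁ : UnitaryGroup.arch (Fp L) L (IsCMField.complexConj L) (1 + 1) (hermD L e₁ dV₁ hdV₁ dW₁ hdW₁) →
      {w : InfinitePlace L // w.IsComplex} → Matrix (Fin 1 ⊕ Fin 1) (Fin 1 ⊕ Fin 1) ℂ)
    (hFr₁ : ∀ a w, Fr₁ a w = T₁ w * Matrix.reindex (e₂ (n := 1)).symm (e₂ (n := 1)).symm
      (((UnitaryGroup.archAt (Fp L) L (IsCMField.complexConj L) (1 + 1) (hermD L e₁ dV₁ hdV₁ dW₁ hdW₁) w
        (UnitaryGroup.complexConj_smul_infinitePlace L w.1) (IsCMField.complexConj_ne_one L) a :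
          UnitaryGroup.archLocal L (1 + 1) (hermD L e₁ dV₁ hdV₁ dW₁ hdW₁) w) : GL (Fin (1 + 1)) ℂ) : Matrix (Fin (1 + 1)) (Fin (1 + 1)) ℂ) * T₁inv w)
    (hT₁1 : ∀ w, T₁ w * T₁inv w = 1) (hT₁2 : ∀ w, T₁inv w * T₁ w = 1)
    (hT₁iv : ∀ w (u : GL (Fin (1 + 1)) ℂ), u ∈ UnitaryGroup.archLocal L (1 + 1) (hermD L e₁ dV₁ hdV₁ dW₁ hdW₁) w →
      IsUnipM (n := 1) (u : Matrix (Fin (1 + 1)) (Fin (1 + 1)) ℂ) →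
        ∃ b : Matrix (Fin 1) (Fin 1) ℂ, bᴴ = b ∧ T₁ w * Matrix.reindex (e₂ (n := 1)).symm (e₂ (n := 1)).symm (u : Matrix _ _ ℂ) * T₁inv w = fromBlocks 1 b 0 1)
    (hT₁N : ∀ w (b : Matrix (Fin 1) (Fin 1) ℂ), bᴴ = b → ∃ u : GL (Fin (1 + 1)) ℂ,
      u ∈ UnitaryGroup.archLocal L (1 + 1) (hermD L e₁ dV₁ hdV₁ dW₁ hdW₁) w ∧ IsUnipM (n := 1) (u : Matrix (Fin (1 + 1)) (Fin (1 + 1)) ℂ) ∧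
        T₁ w * Matrix.reindex (e₂ (n := 1)).symm (e₂ (n := 1)).symm (u : Matrix _ _ ℂ) * T₁inv w = fromBlocks 1 b 0 1)
    [MeasurableSpace ↥(unipDeltaArch L e₁ dV₁ hdV₁ dW₁ hdW₁)] [BorelSpace ↥(unipDeltaArch L e₁ dV₁ hdV₁ dW₁ hdW₁)] :
    ∃ (Φ : ↥(unipDeltaArch L e₁ dV₁ hdV₁ dW₁ hdW₁) ≃ₜ ({w : InfinitePlace L // w.IsComplex} → (Fin 1 → Fin 1 → ℝ)))
      (cν : Measure ↥(unipDeltaArch L e₁ dV₁ hdV₁ dW₁ hdW₁) → ℝ≥0),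
      (∀ u v, Φ (u * v) = Φ u + Φ v) ∧
      (∀ (u : ↥(unipDeltaArch L e₁ dV₁ hdV₁ dW₁ hdW₁)) (w : {w : InfinitePlace L // w.IsComplex}),
        Fr₁ (u : UnitaryGroup.arch (Fp L) L (IsCMField.complexConj L) (1 + 1) (hermD L e₁ dV₁ hdV₁ dW₁ hdW₁)) w = fromBlocks 1 (hermOfReal (Φ u w)) 0 1) ∧
      (∀ (ν : Measure ↥(unipDeltaArch L e₁ dV₁ hdV₁ dW₁ hdW₁)) [ν.IsHaarMeasure]
        (G : ({w : InfinitePlace L // w.IsComplex} → (Fin 1 → Fin 1 → ℝ)) → ℂ), ∫ u, G (Φ u) ∂ν = cν ν • ∫ r, G r) ∧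
      (∀ (ν : Measure ↥(unipDeltaArch L e₁ dV₁ hdV₁ dW₁ hdW₁)) [ν.IsHaarMeasure]
        (x₀ h : UnitaryGroup.arch (Fp L) L (IsCMField.complexConj L) (1 + 1) (hermD L e₁ dV₁ hdV₁ dW₁ hdW₁))
        (eb : {w : InfinitePlace L // w.IsComplex} → Matrix (Fin 1) (Fin 1) ℂ → ℂ) (Wt : ↥(unipDeltaArch L e₁ dV₁ hdV₁ dW₁ hdW₁) → ℂ),
        (∀ u : ↥(unipDeltaArch L e₁ dV₁ hdV₁ dW₁ hdW₁),
          Wt u = ∏ w, eb w (Matrix.toBlocks₁₂ (Fr₁ (u : UnitaryGroup.arch (Fp L) L (IsCMField.complexConj L) (1 + 1) (hermD L e₁ dV₁ hdV₁ dW₁ hdW₁)) w))) →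
        ∀ F : {w : InfinitePlace L // w.IsComplex} → Matrix (Fin 1 ⊕ Fin 1) (Fin 1 ⊕ Fin 1) ℂ → ℂ,
          ∫ u : ↥(unipDeltaArch L e₁ dV₁ hdV₁ dW₁ hdW₁), Wt u * ∏ w, F w (Fr₁
              (x₀ * (u : UnitaryGroup.arch (Fp L) L (IsCMField.complexConj L) (1 + 1) (hermD L e₁ dV₁ hdV₁ dW₁ hdW₁)) * h) w) ∂ν =
            ((cν ν : ℝ) : ℂ) * ∏ w, ∫ t : ℝ, eb w (hermOfReal (fun _ _ : Fin 1 => t)) *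
              F w (Fr₁ x₀ w * fromBlocks 1 (hermOfReal (fun _ _ : Fin 1 => t)) 0 1 * Fr₁ h w)) ∧
      (∀ (ν : Measure ↥(unipDeltaArch L e₁ dV₁ hdV₁ dW₁ hdW₁)) [ν.IsHaarMeasure]
        (h : UnitaryGroup.arch (Fp L) L (IsCMField.complexConj L) (1 + 1) (hermD L e₁ dV₁ hdV₁ dW₁ hdW₁))
        (eb : {w : InfinitePlace L // w.IsComplex} → Matrix (Fin 1) (Fin 1) ℂ → ℂ) (Wt : ↥(unipDeltaArch L e₁ dV₁ hdV₁ dW₁ hdW₁) → ℂ),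
        (∀ u : ↥(unipDeltaArch L e₁ dV₁ hdV₁ dW₁ hdW₁),
          Wt u = ∏ w, eb w (Matrix.toBlocks₁₂ (Fr₁ (u : UnitaryGroup.arch (Fp L) L (IsCMField.complexConj L) (1 + 1) (hermD L e₁ dV₁ hdV₁ dW₁ hdW₁)) w))) →
        ∀ F : {w : InfinitePlace L // w.IsComplex} → Matrix (Fin 1 ⊕ Fin 1) (Fin 1 ⊕ Fin 1) ℂ → ℂ,
          ∫ u : ↥(unipDeltaArch L e₁ dV₁ hdV₁ dW₁ hdW₁), Wt u * ∏ w, F w (Fr₁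
              (UnitaryGroup.archPart (Fp L) L (IsCMField.complexConj L) (1 + 1) (hermD L e₁ dV₁ hdV₁ dW₁ hdW₁) (weylDelta L e₁ dV₁ hdV₁ dW₁ hdW₁) *
                (u : UnitaryGroup.arch (Fp L) L (IsCMField.complexConj L) (1 + 1) (hermD L e₁ dV₁ hdV₁ dW₁ hdW₁)) * h) w) ∂ν =
            ((cν ν : ℝ) : ℂ) * ∏ w, ∫ t : ℝ, eb w (hermOfReal (fun _ _ : Fin 1 => t)) *
              F w (T₁ w * fromBlocks 1 0 0 (-1) * T₁inv w * fromBlocks 1 (hermOfReal (fun _ _ : Fin 1 => t)) 0 1 * Fr₁ h w)) := by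
  obtain ⟨Φ, cν, hΦ, hΦFr, htr, hprod, hweyl⟩ :=
    exists_frameCoordinates_haarRatio_prod L e₁ dV₁ hdV₁ dW₁ hdW₁ T₁ T₁inv Fr₁ hFr₁ hT₁1 hT₁2 hT₁iv hT₁N
  refine ⟨Φ, cν, hΦ, hΦFr, htr, fun ν hν x₀ h eb Wt hWt F => ?_, fun ν hν h eb Wt hWt F => ?_⟩
  · rw [hprod ν x₀ h eb Wt hWt F]
    exact congrArg _ (Finset.prod_congr rfl fun w _ => integral_fin_one_eq_integral_real _)
  · rw [hweyl ν h eb Wt hWt F]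
    exact congrArg _ (Finset.prod_congr rfl fun w _ => integral_fin_one_eq_integral_real _)

end Summit.HodgeConjecture.HodgeConjecture.Cruxes.HLiu418.K2LiuKindOneLineArchWhittakerProduct

end
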